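import Literature.AlgebraicGeometry.Frobenioids.Thm49Sub
import Literature.AlgebraicGeometry.Frobenioids.PrimesEquivalence
import Literature.AlgebraicGeometry.Frobenioids.DivisorMonoidCategoryTheoreticity
import Literature.AlgebraicGeometry.Frobenioids.PreFrobenioidDataOfFunctor
import HarnessLib

/-!
# [FrdI] Theorem 4.9, compatibility clause: "`Ψ^Φ` is compatible with the `Ψ^Prime` of Theorem 4.2 (ii)"
# — PROVED for every divisor-computing `Ψ^Φ` (the output of row T49-L02) and every `Ψ^Prime`

Mochizuki, *The geometry of Frobenioids I: the general theory*, Kyushu J. Math. **62** (2008) 293–400,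
§4, Theorem 4.9, statement kurims p. 88 l. 40 – p. 89 l. 2 [cite: MochizukiFrdI2008, Thm. 4.9 p.89]:

> "… there exists an isomorphism of functors `Ψ^Φ : Φ₁ ⥲ Φ₂` lying over `Ψ`, which [when `C₁`, `C₂` are
> of isotropic but not group-like type] is compatible with the isomorphism `Ψ^Prime` of Theorem 4.2, (ii)
> [i.e. maps `Φ₁(A₁)_𝔭₁` onto `Φ₂(A₂)_𝔭₂` for `𝔭₂ = Ψ^Prime(𝔭₁)`]."

The compatibility clause is abc-iut-L1-t3's typed `PreFrobenioidData.Thm49_compat` (node `FrdI:Thm4.9`,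
`DivisorMonoidCategoryTheoreticity.lean`, its `TODO(general form)`; FACT-LIST F-1033). In print it is
evident "from the construction": `Ψ^Φ_A` is THE divisor transport `Div(φ) ↦ Div(Ψ φ)` (pre-steps `φ` out of
`A`; the conclusion of the S5 row T49-L02 `FrdI.T49.SufficesRightEqLeft`, `Thm49Sub.lean`), and `Ψ^Prime(𝔭)`
is characterised by "`Div(φ) ∈ Φ₁(A)_𝔭 ⟺ Div(Ψ φ) ∈ Φ₂(Ψ A)_{Ψ^Prime(𝔭)}` for co-angular pre-steps `φ`
out of `A`" (clause (a) of the typed Thm. 4.2 (ii) / row T42-L08 `PsiPrimeBijection`). Since every element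
of `Φ₁(A)` is the zero divisor of a co-angular pre-step out of `A` (Def. 1.3 (iii)(d)), the two together
give `x ∈ Φ₁(A)_𝔭 ⟺ Ψ^Φ_A(x) ∈ Φ₂(Ψ A)_{Ψ^Prime(𝔭)}` — for ANY family with the divisor clause and ANY
primes family with clause (a); no isotropy / group-likeness premise is used (they are the antecedents of the
typed clause and are discarded).

PROOF-ONLY companion (seat abc-iut-w4-d105, gen 2; S5 sub-DAG `plan/L1/SUBDAG-FrdI-Thm42-Thm49.md`, node
`FrdI:Thm4.9` compatibility clause). Contents:
* `FrdI.T49.mem_primesSubmonoid_iff_of_divClause` — the pointwise statement for one `(A, 𝔭, 𝔭')`;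
* `FrdI.T49.thm49_compat_of_divClause` — the typed `PreFrobenioidData.Thm49_compat` for the operations
  `ofFunctor Φ_i F_i` of Frobenioids, ANY `Ψ^Φ` whose components compute divisors of co-angular pre-steps
  and ANY `Ψ^Prime` with clause (a);
* `FrdI.T49.exists_thm49_compat_of_sufficesRightEqLeft` — in a `T42.Setting`, row T49-L02
  (`SufficesRightEqLeft`, hypothesis) yields a `Ψ^Φ` over `Ψ` (closing shape of `Thm49`) that computes
  divisors of all pre-steps AND satisfies `Thm49_compat` with respect to the given `Ψ^Prime`;
* `FrdI.T49.invDiv_map_mem_carrier_of_clauseB` — the "carrier" hypothesis of `SufficesRightEqLeft`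
  (primary pre-steps INTO `A`) follows from clause (b) of Thm. 4.2 (ii), so that `SufficesRightEqLeft` is
  callable on the output of `FrdI.T49.exists_primesEquiv_rightEqLeftAt_of_cover`
  (`Thm49RightEqLeftAssembly.lean`, seat abc-iut-w4-d099);
The composite with `FrdI.T49.exists_primesEquiv_rightEqLeftAt_of_cover` (rows T49-L05–L08′) is the companion
file `Thm49CompatAssembly.lean`. No new definitions; nothing of [FrdI] restated; nothing here bears on [IUTchIII] Cor. 3.12.
-/

namespace Literature.AlgebraicGeometry.Frobenioids

open CategoryTheory Opposite

namespace FrdI.T49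

universe w v v' u u'

variable {D₁ : Type u} [Category.{v} D₁] {Φ₁ : D₁ᵒᵖ ⥤ CommMonCat.{w}} {C₁ : Type u'} [Category.{v'} C₁]
  {D₂ : Type u} [Category.{v} D₂] {Φ₂ : D₂ᵒᵖ ⥤ CommMonCat.{w}} {C₂ : Type u'} [Category.{v'} C₂]

/-- **Thm. 4.9, compatibility with `Ψ^Prime`, pointwise** (p. 89 ll. 1–2): for a Frobenioid `C₁`, a map
`m : Φ₁(A) → Φ₂(Ψ A)` computing `Div(Ψ φ) = m(Div φ)` on the co-angular pre-steps `φ` out of `A`, and primes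
`𝔭 ⊆ Φ₁(A)`, `𝔭' ⊆ Φ₂(Ψ A)` corresponding as in Thm. 4.2 (ii) clause (a)
("`Div φ ∈ Φ₁(A)_𝔭 ⟺ Div(Ψ φ) ∈ Φ₂(Ψ A)_𝔭'`"), one has `x ∈ Φ₁(A)_𝔭 ⟺ m(x) ∈ Φ₂(Ψ A)_𝔭'` for every `x`
— every `x` being a zero divisor `Div φ` (Def. 1.3 (iii)(d)). [cite: MochizukiFrdI2008, Thm. 4.9 p.89] -/
theorem mem_primesSubmonoid_iff_of_divClause (F₁ : C₁ ⥤ ElemFrobenioid Φ₁) (F₂ : C₂ ⥤ ElemFrobenioid Φ₂)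
    (Ψ : C₁ ≌ C₂) (hF₁ : PreFrobenioid.IsFrobenioid F₁) {A : C₁}
    (𝔭 : Primes (Φ₁.obj (op (PreFrobenioid.baseObj F₁ A))))
    (𝔭' : Primes (Φ₂.obj (op (PreFrobenioid.baseObj F₂ (Ψ.functor.obj A)))))
    (he : ∀ ⦃B : C₁⦄ (φ : A ⟶ B), PreFrobenioid.IsCoAngularPreStep F₁ φ →
      (PreFrobenioid.Div F₁ φ ∈ 𝔭.submonoid ↔ PreFrobenioid.Div F₂ (Ψ.functor.map φ) ∈ 𝔭'.submonoid))
    (m : Φ₁.obj (op (PreFrobenioid.baseObj F₁ A)) → Φ₂.obj (op (PreFrobenioid.baseObj F₂ (Ψ.functor.obj A))))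
    (hm : ∀ ⦃B : C₁⦄ (φ : A ⟶ B), PreFrobenioid.IsCoAngularPreStep F₁ φ →
      m (PreFrobenioid.Div F₁ φ) = PreFrobenioid.Div F₂ (Ψ.functor.map φ))
    (x : Φ₁.obj (op (PreFrobenioid.baseObj F₁ A))) :
    x ∈ 𝔭.submonoid ↔ m x ∈ 𝔭'.submonoid := by
  obtain ⟨B, φ, hφ, rfl⟩ := hF₁.iii_d_under_surj A x
  rw [hm φ hφ]
  exact he φ hφ

/-- **Thm. 4.9, compatibility clause — the typed `PreFrobenioidData.Thm49_compat`** for Frobenioids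
`C_i → F_{Φ_i}` (operations `ofFunctor Φ_i F_i`): ANY isomorphism of functors `Ψ^Φ : Φ₁ ⥲ Φ₂` over `Ψ` whose
components compute the zero divisors of co-angular pre-steps ("from the construction", p. 89 ll. 12–33) is
compatible with ANY family `e = Ψ^Prime` satisfying clause (a) of Thm. 4.2 (ii): `Ψ^Φ_A` maps `Φ₁(A)_𝔭` onto
`Φ₂(Ψ A)_{e(𝔭)}`. The isotropy / non-group-likeness antecedents of the typed clause are not needed.
[cite: MochizukiFrdI2008, Thm. 4.9 p.89] -/
theorem thm49_compat_of_divClause (F₁ : C₁ ⥤ ElemFrobenioid Φ₁) (F₂ : C₂ ⥤ ElemFrobenioid Φ₂)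
    (Ψ : C₁ ≌ C₂) (hF₁ : PreFrobenioid.IsFrobenioid F₁)
    (E : PreFrobenioidData.DivisorMonoidIsoOver (PreFrobenioidData.ofFunctor Φ₁ F₁)
      (PreFrobenioidData.ofFunctor Φ₂ F₂) Ψ)
    (e : ∀ A : C₁, Primes (Φ₁.obj (op (PreFrobenioid.baseObj F₁ A))) ≃
      Primes (Φ₂.obj (op (PreFrobenioid.baseObj F₂ (Ψ.functor.obj A)))))
    (he : ∀ (A : C₁) (𝔭 : Primes (Φ₁.obj (op (PreFrobenioid.baseObj F₁ A)))) ⦃B : C₁⦄ (φ : A ⟶ B),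
      PreFrobenioid.IsCoAngularPreStep F₁ φ →
        (PreFrobenioid.Div F₁ φ ∈ 𝔭.submonoid ↔
          PreFrobenioid.Div F₂ (Ψ.functor.map φ) ∈ (e A 𝔭).submonoid))
    (hE : ∀ ⦃A B : C₁⦄ (φ : A ⟶ B), PreFrobenioid.IsCoAngularPreStep F₁ φ →
      E.iso A (PreFrobenioid.Div F₁ φ) = PreFrobenioid.Div F₂ (Ψ.functor.map φ)) :
    Literature.AlgebraicGeometry.Frobenioids.PreFrobenioidData.Thm49_compat
      (PreFrobenioidData.ofFunctor Φ₁ F₁) (PreFrobenioidData.ofFunctor Φ₂ F₂) Ψ E e :=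
  fun _ _ _ _ A 𝔭 x =>
    mem_primesSubmonoid_iff_of_divClause F₁ F₂ Ψ hF₁ 𝔭 (e A 𝔭) (he A 𝔭) (E.iso A) (fun _ φ hφ => hE φ hφ) x

/-- **Thm. 4.9, existence WITH the compatibility clause from row T49-L02** (p. 89 ll. 6–36 and ll. 1–2):
in a `T42.Setting` (perfect, isotropic type; `Ψ`, `Ψ⁻¹` preserving primary pre-steps), given a family
`e = Ψ^Prime` with clause (a) of Thm. 4.2 (ii) and the carrier clause, and the coincidence of the right-hand
and left-hand isomorphisms of Thm. 4.2 (iii) at all universally Div-Frobenius-trivial objects, row T49-L02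
`SufficesRightEqLeft` (hypothesis) produces an isomorphism of functors `Ψ^Φ : Φ₁ ⥲ Φ₂` over `Ψ` — the closing
shape of the typed `Thm49` — computing `Div(Ψ φ) = Ψ^Φ_A(Div φ)` on all pre-steps and satisfying the typed
compatibility clause `Thm49_compat` with respect to `e`. [cite: MochizukiFrdI2008, Thm. 4.9 p.89] -/
theorem exists_thm49_compat_of_sufficesRightEqLeft (h : SufficesRightEqLeft.{w, v, v', u, u'})
    (F₁ : C₁ ⥤ ElemFrobenioid Φ₁) (F₂ : C₂ ⥤ ElemFrobenioid Φ₂) (Ψ : C₁ ≌ C₂) (S : T42.Setting F₁ F₂ Ψ)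
    (hprim : ∀ ⦃X Y : C₁⦄ (φ : X ⟶ Y), PreFrobenioid.IsPrimaryPreStep F₁ φ →
      PreFrobenioid.IsPrimaryPreStep F₂ (Ψ.functor.map φ))
    (hprim' : ∀ ⦃X Y : C₂⦄ (φ : X ⟶ Y), PreFrobenioid.IsPrimaryPreStep F₂ φ →
      PreFrobenioid.IsPrimaryPreStep F₁ (Ψ.inverse.map φ))
    (e : ∀ A : C₁, Primes (Φ₁.obj (op (PreFrobenioid.baseObj F₁ A))) ≃
      Primes (Φ₂.obj (op (PreFrobenioid.baseObj F₂ (Ψ.functor.obj A)))))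
    (he : ∀ (A : C₁) (𝔭 : Primes (Φ₁.obj (op (PreFrobenioid.baseObj F₁ A)))) ⦃B : C₁⦄ (φ : A ⟶ B),
      PreFrobenioid.IsCoAngularPreStep F₁ φ →
        (PreFrobenioid.Div F₁ φ ∈ 𝔭.submonoid ↔
          PreFrobenioid.Div F₂ (Ψ.functor.map φ) ∈ (e A 𝔭).submonoid))
    (hcar : ∀ (A : C₁) ⦃E : C₁⦄ (ε : E ⟶ A) (hε : PreFrobenioid.IsPrimaryPreStep F₁ ε)
      (𝔭 : Primes (Φ₁.obj (op (PreFrobenioid.baseObj F₁ A)))),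
      PreFrobenioid.invDiv F₁ ε hε.1.2 ∈ 𝔭.carrier →
        ∀ h₂ : PreFrobenioid.IsBaseIso F₂ (Ψ.functor.map ε),
          PreFrobenioid.invDiv F₂ (Ψ.functor.map ε) h₂ ∈ (e A 𝔭).carrier)
    (hRL : ∀ (A : C₁), PreFrobenioid.IsUniversallyDivFrobeniusTrivial F₁ A →
      ∀ 𝔭 : Primes (Φ₁.obj (op (PreFrobenioid.baseObj F₁ A))), RightEqLeftAt F₁ F₂ Ψ A 𝔭 (e A 𝔭)) :
    ∃ E : PreFrobenioidData.DivisorMonoidIsoOver (PreFrobenioidData.ofFunctor Φ₁ F₁)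
        (PreFrobenioidData.ofFunctor Φ₂ F₂) Ψ,
      (∀ ⦃A B : C₁⦄ (φ : A ⟶ B), PreFrobenioid.IsPreStep F₁ φ →
          E.iso A (PreFrobenioid.Div F₁ φ) = PreFrobenioid.Div F₂ (Ψ.functor.map φ)) ∧
      Literature.AlgebraicGeometry.Frobenioids.PreFrobenioidData.Thm49_compat
        (PreFrobenioidData.ofFunctor Φ₁ F₁) (PreFrobenioidData.ofFunctor Φ₂ F₂) Ψ E e := by
  obtain ⟨m, hdiv, hnat⟩ := h F₁ F₂ Ψ S hprim hprim' e hcar hRL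
  refine ⟨⟨m, fun A B φ x => hnat φ x⟩, hdiv, ?_⟩
  exact thm49_compat_of_divClause F₁ F₂ Ψ S.isFrobenioid₁ _ e he fun _ _ φ hφ => hdiv φ hφ.2

/-- **The "carrier" clause of row T49-L02 from clause (b) of Thm. 4.2 (ii)** (p. 80 ll. 18–33: primes as
classes of primary steps INTO `A`): in a `T42.Setting`, if `e = Ψ^Prime` satisfies clause (b) at `(A, 𝔭)`
("`(ψ^*)⁻¹Div ψ ∈ Φ₁(A)_𝔭 ⟺ ((Ψψ)^*)⁻¹Div(Ψ ψ) ∈ Φ₂(Ψ A)_{e(𝔭)}` for co-angular pre-steps `ψ` into `A`"),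
then for every primary pre-step `ε : E → A` with `(ε^*)⁻¹Div ε ∈ 𝔭` the element `((Ψε)^*)⁻¹Div(Ψ ε)` lies in
the prime `e(𝔭)` itself (not merely in the submonoid it generates): it is `≠ 1` because `Ψ ε` is a step.
[cite: MochizukiFrdI2008, Thm. 4.2 (ii) p.80] -/
theorem invDiv_map_mem_carrier_of_clauseB (F₁ : C₁ ⥤ ElemFrobenioid Φ₁) (F₂ : C₂ ⥤ ElemFrobenioid Φ₂)
    (Ψ : C₁ ≌ C₂) (S : T42.Setting F₁ F₂ Ψ)
    (e : ∀ A : C₁, Primes (Φ₁.obj (op (PreFrobenioid.baseObj F₁ A))) ≃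
      Primes (Φ₂.obj (op (PreFrobenioid.baseObj F₂ (Ψ.functor.obj A)))))
    (hb : ∀ (A : C₁) (𝔭 : Primes (Φ₁.obj (op (PreFrobenioid.baseObj F₁ A)))) ⦃B : C₁⦄ (ψ : B ⟶ A),
      PreFrobenioid.IsCoAngularPreStep F₁ ψ →
        ((∃ y ∈ 𝔭.submonoid, pull Φ₁ (PreFrobenioid.Base F₁ ψ) y = PreFrobenioid.Div F₁ ψ) ↔
          ∃ y ∈ (e A 𝔭).submonoid, pull Φ₂ (PreFrobenioid.Base F₂ (Ψ.functor.map ψ)) y =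
            PreFrobenioid.Div F₂ (Ψ.functor.map ψ)))
    (A : C₁) ⦃E : C₁⦄ (ε : E ⟶ A) (hε : PreFrobenioid.IsPrimaryPreStep F₁ ε)
    (𝔭 : Primes (Φ₁.obj (op (PreFrobenioid.baseObj F₁ A))))
    (h𝔭 : PreFrobenioid.invDiv F₁ ε hε.1.2 ∈ 𝔭.carrier)
    (h₂ : PreFrobenioid.IsBaseIso F₂ (Ψ.functor.map ε)) :
    PreFrobenioid.invDiv F₂ (Ψ.functor.map ε) h₂ ∈ (e A 𝔭).carrier := by
  have hco : PreFrobenioid.IsCoAngular F₁ ε :=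
    PreFrobenioid.isCoAngular_of_isIsotropic_codomains F₁ ε fun Z _ => S.isotropic₁ Z
  obtain ⟨y, hy, hyx⟩ := (hb A 𝔭 ε ⟨hco, hε.1⟩).mp
    ⟨_, Submonoid.subset_closure h𝔭, PreFrobenioid.pull_invDiv ε hε.1.2⟩
  haveI : IsIso (PreFrobenioid.Base F₂ (Ψ.functor.map ε)) := h₂
  have hy' : y = PreFrobenioid.invDiv F₂ (Ψ.functor.map ε) h₂ :=
    pull_injective_of_isIso Φ₂ (PreFrobenioid.Base F₂ (Ψ.functor.map ε))
      (by rw [hyx, PreFrobenioid.pull_invDiv])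
  rcases ((e A 𝔭).mem_submonoid_iff' y).mp hy with h1 | h1
  · exact absurd (by rw [← hyx, h1, map_one]) (PreFrobenioid.div_ne_one_of_isStep S.isotropic₂
      (S.step_map ε (PreFrobenioid.IsPrimaryPreStep.isStep S.isFrobenioid₁.isPreFrobenioid hε)))
  · exact hy' ▸ h1

end FrdI.T49

end Literature.AlgebraicGeometry.Frobenioids
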